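import Summits.ResolutionOfSingularities.ResolutionOfSingularities.Theorems.FrobeniusClosingPatchingRelPerfectRoofIsBlowup
import HarnessLib

/-!
# Crux `PatchingRelPerfect` (stmt-ResolutionOfSingularities-16161), chain w52:
# P0 re-glue stub γ — the dimension-`≤ 4` slice from LU and the BLOW-UP-FORM roof engine

[OURS · L1 W5.2 · stub γ] In the planner's v4 proposal P0 (CHAIN.md v0.1 §3) the roof engine is
weakened to `RoofEngineBlowup p`: it resolves integral fourfolds over a perfect field every closed
point of which has a regular roof WHICH IS A BLOWING UP along a non-zero ideal sheaf.  The slice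
stub must then supply such roofs:

  `stub_sliceOfEngineBlowup : ∀ p, p.Prime → PrintedInputs → RelLUPerfect p → RoofEngineBlowup p → ResPerfectIntegralDimLeFour p`

(written UNFOLDED, binder-for-binder as the landed `stub_sliceOfEngine`, p170125, with the
engine hypothesis `hR` in the shape of the typed target `ChainW52.RoofEngineBlowup`).  The proof
is the landed one with the resolving system kept PROJECTIVE (`ProjModel.exists_regCentre_of_
hasRegularCentre`), the iterated join taken among projective models
(`exists_projHom_forall_nonempty_hom`, W4′a) and the roofs produced as blowing ups
(`exists_roof_isBlowup`, W4′b: Liu 8.1.24 for models).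

* `PatchingRelPerfect.SliceOfEngine.hasResolution_projective_of_dim_le_four_blowup` — the
  projective integral case under the blow-up-form engine;
* `stub_sliceOfEngineBlowup` — the stub.

CONDITIONAL on its hypotheses only (Cossart–Piltant 2019 in dimension `≤ 3` among them); nothing
here is a statement of the manuscript under review.

## Sources

* O. Zariski, Ann. of Math. 45 (1944), Fundamental Theorem p. 539. [Zariski1944]
* O. Piltant, RACSAM 107 (2013), Prop. 5.1 and Cor. 5.7. [Piltant2013]
* Q. Liu, *Algebraic Geometry and Arithmetic Curves* (2002), Thm. 8.1.24. [Liu2002]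
* V. Cossart, O. Piltant, J. Algebra 529 (2019), Thm. 1.1. [CossartPiltant2019]
-/

set_option linter.dupNamespace false -- single-problem summit: doubled namespace component is forced

noncomputable section

open CategoryTheory CategoryTheory.Limits AlgebraicGeometry Literature.AlgebraicGeometry.Resolution
open Literature.AlgebraicGeometry (Motives.projectiveSpace Motives.isProper_projectiveSpace
  Motives.IsProjectiveOver)
open TopologicalSpace IsLocalRing

namespace Summit.ResolutionOfSingularities.ResolutionOfSingularities.Theorems

namespace PatchingRelPerfect.SliceOfEngine

variable {k K : Type} [Field k] [Field K] [Algebra k K]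

/-- **The projective integral case of the slice, blow-up-form engine.** For a field `k` with
relative local uniformization over `k` (fibrewise shape `hLU`) and the BLOW-UP-FORM roof engine
over `k` (`hR`: integral fourfolds whose closed points have regular roofs which are blowing ups
along non-zero ideal sheaves have resolutions), every integral closed subscheme `X ⊆ ℙⁿ_k` of
dimension `≤ 4` has a resolution of singularities, modulo `CossartPiltant2019` (dimension `≤ 3`).
As `hasResolution_projective_of_dim_le_four`, with a PROJECTIVE resolving system, the projective
iterated join (`exists_projHom_forall_nonempty_hom`) and roofs which are blowing ups
(`exists_roof_isBlowup`). [cite: Piltant2013, Prop. 5.1 and Cor. 5.7; Zariski1944, p. 539]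
[cite: Liu2002, Thm. 8.1.24] -/
theorem hasResolution_projective_of_dim_le_four_blowup (hCP : CossartPiltant2019.{0}) {k : Type}
    [Field k]
    (hLU : ∀ (K : Type) [Field K] [Algebra k K] (O : ValuationSubring K) (R : Subalgebra k K),
      R.FG → IsFractionRing R K → R.toSubring ≤ O.toSubring →
        ∃ (A : Subalgebra k K) (h : A.toSubring ≤ O.toSubring), R ≤ A ∧ A.FG ∧
          IsRegularLocalRing (Localization.AtPrime
            (Ideal.comap (Subring.inclusion h) (IsLocalRing.maximalIdeal O))))
    (hR : ∀ (M : Scheme.{0}) (g : M ⟶ Spec (.of k)) [IsSeparated g] [LocallyOfFiniteType g]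
      [QuasiCompact g] [IsIntegral M], topologicalKrullDim M = 4 →
      (∀ m : M, IsClosed ({m} : Set M) →
        ∃ (N : Scheme.{0}) (gN : N ⟶ Spec (.of k)) (q : M ⟶ N) (I : N.IdealSheafData),
          IsSeparated gN ∧ LocallyOfFiniteType gN ∧ QuasiCompact gN ∧ IsIntegral N ∧
          q ≫ gN = g ∧ IsProper q ∧ IsBirational q ∧ topologicalKrullDim N ≤ 4 ∧
          IsRegularLocalRing (N.presheaf.stalk (q.base m)) ∧ I ≠ ⊥ ∧ IsBlowup q I) →
      Scheme.HasResolution M)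
    {n : ℕ} (X : Scheme.{0}) [IsIntegral X] (ι : X ⟶ (Motives.projectiveSpace n k).left)
    [IsClosedImmersion ι] (hX : topologicalKrullDim X ≤ ((4 : ℕ) : WithBot ℕ∞)) :
    Scheme.HasResolution X := by
  classical
  haveI : IsProper (Motives.projectiveSpace n k).hom := Motives.isProper_projectiveSpace n k
  let πX : X ⟶ Spec (.of k) := ι ≫ (Motives.projectiveSpace n k).hom
  have hproj : Motives.IsProjectiveOver (Over.mk πX) := ⟨n, Over.homMk ι rfl, ‹_›⟩
  haveI : LocallyOfFiniteType πX := inferInstance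
  -- an affine chart `U = Spec A` of `X`
  obtain ⟨_, ⟨U', hU', rfl⟩, hηU, -⟩ := X.isBasis_affineOpens.exists_subset_of_mem_open
    (Set.mem_univ (genericPoint X)) isOpen_univ
  let U : X.Opens := U'
  have hU : IsAffineOpen U := hU'
  haveI : IsAffine U := hU
  haveI : Nonempty U := ⟨⟨_, hηU⟩⟩
  let A : Type := Γ(U, ⊤)
  -- `A` is a finitely generated `k`-algebra
  let g : (U : Scheme.{0}) ⟶ Spec (.of k) := U.ι ≫ πX
  let ψ : k →+* A := g.appTop.hom.comp (Scheme.ΓSpecIso (.of k)).inv.hom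
  have hψ : ψ.FiniteType := by
    have h1 : g.appTop.hom.FiniteType :=
      (HasRingHomProperty.iff_of_isAffine (P := @LocallyOfFiniteType)).mp inferInstance
    exact h1.comp (RingHom.FiniteType.of_surjective _
      (Scheme.ΓSpecIso (.of k)).symm.commRingCatIsoToRingEquiv.surjective)
  letI : Algebra k A := ψ.toAlgebra
  haveI hft : Algebra.FiniteType k A := hψ
  -- its fraction field `K`, and `X` as a projective model of `K/k`
  let K : Type := FractionRing A
  let j : Spec (.of A) ⟶ X := U.toScheme.isoSpec.inv ≫ U.ι
  have hj : j ≫ πX = Spec.map (CommRingCat.ofHom (algebraMap k A)) := by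
    change (U.toScheme.isoSpec.inv ≫ U.ι) ≫ πX = Spec.map (CommRingCat.ofHom ψ)
    rw [Category.assoc, isoSpec_inv_comp]
    rfl
  let M₀ : ProjModel k K := ProjModel.ofChart (K := K) X πX hproj A j hj
  -- `A` as a subalgebra `A₀ ⊆ K`, finitely generated with `Frac A₀ = K`
  let toK : A →ₐ[k] K := IsScalarTower.toAlgHom k A K
  let A₀ : Subalgebra k K := toK.range
  have hA₀fg : A₀.FG := by
    rw [show A₀ = Subalgebra.map toK ⊤ from (Algebra.map_top toK).symm]
    exact Subalgebra.FG.map toK hft.out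
  haveI hA₀fr : IsFractionRing A₀ K := by
    refine IsFractionRing.of_field A₀ K fun z => ?_
    obtain ⟨a, b, -, rfl⟩ := IsFractionRing.div_surjective (A := A) z
    exact ⟨⟨algebraMap A K a, a, rfl⟩, ⟨algebraMap A K b, b, rfl⟩, rfl⟩
  -- `trdeg_k K` is a natural number `m`, and `dim X = m`
  haveI : Algebra.FiniteType k A₀ := A₀.fg_iff_finiteType.mp hA₀fg
  obtain ⟨m, -, htrA₀⟩ := exists_ringKrullDim_eq_and_trdeg_eq k A₀
  have hKm : Algebra.trdeg k K = m := (trdeg_eq_trdeg_of_isFractionRing A₀).trans htrA₀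
  have hXm : topologicalKrullDim X = m :=
    Pialt.OpenRange.properModel_topologicalKrullDim_eq_of_trdeg M₀.toProperModel hKm
  by_cases hm3 : m ≤ 3
  · -- dimension `≤ 3`: Cossart–Piltant
    have h3 : topologicalKrullDim X ≤ 3 := by
      rw [hXm]
      exact_mod_cast hm3
    exact hCP k X πX inferInstance inferInstance inferInstance inferInstance h3
  -- dimension `4`
  have hm4 : m ≤ 4 := by
    have h : (m : WithBot ℕ∞) ≤ ((4 : ℕ) : WithBot ℕ∞) := hXm ▸ hX
    exact_mod_cast h
  have hm : m = 4 := by omega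
  subst hm
  -- a finite resolving system of affine models, from (LU)
  have hcov : ∀ v : ZariskiRiemannSpace k K, ∃ T : Subalgebra k K,
      (T.FG ∧ IsFractionRing T K) ∧ ZariskiRiemannSpace.HasRegularCentre T v :=
    fun v => exists_hasRegularCentre_of_relLU (hLU K) A₀ hA₀fg v
  obtain ⟨𝒯, h𝒯, h𝒯cov⟩ := exists_finite_resolvingSystem' (P := fun T => IsFractionRing T K)
    (fun T hT => (isJ2Ring_of_field k).2 T ((Subalgebra.fg_iff_finiteType T).mp hT)) hcov
  -- their projective closures, as PROJECTIVE models: a finite resolving system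
  have hM : ∀ T : ↥𝒯, ∃ M : ProjModel k K, ∀ w : ZariskiRiemannSpace k K,
      ZariskiRiemannSpace.HasRegularCentre T.1 w → M.RegCentre w := fun T => by
    haveI := (h𝒯 T.1 T.2).2
    exact ProjModel.exists_regCentre_of_hasRegularCentre T.1 (h𝒯 T.1 T.2).1
  choose M hM using hM
  let l : List (ProjModel k K) := 𝒯.attach.toList.map M
  have hlcov : ∀ v : ZariskiRiemannSpace k K, ∃ N ∈ l, N.toProperModel.RegCentre v := by
    intro v
    obtain ⟨T, hT, hTv⟩ := h𝒯cov v
    refine ⟨M ⟨T, hT⟩, ?_, ((M ⟨T, hT⟩).toProperModel_regCentre_iff v).mpr (hM ⟨T, hT⟩ v hTv)⟩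
    exact List.mem_map.mpr ⟨⟨T, hT⟩, Finset.mem_toList.mpr (Finset.mem_attach _ _), rfl⟩
  -- the iterated join of `M₀` with the resolving system, a PROJECTIVE model
  obtain ⟨N, φ₀, hN⟩ := exists_projHom_forall_nonempty_hom M₀ l
  -- `N` is an integral projective `k`-scheme of dimension `4` whose regular roofs are blowing
  -- ups: the blow-up-form engine resolves it
  have hdimN : topologicalKrullDim N.X = 4 := by
    have h := Pialt.OpenRange.properModel_topologicalKrullDim_eq_of_trdeg N.toProperModel hKm
    change topologicalKrullDim N.X = _ at h
    rw [h]
    rfl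
  have hresN : Scheme.HasResolution N.X :=
    hR N.X N.π hdimN fun x _ => exists_roof_isBlowup N hKm l hN hlcov x
  -- transfer to `X = M₀.X` along the proper birational domination `N → M₀`
  have hres₀ : Scheme.HasResolution M₀.X :=
    Scheme.HasResolution.of_isBirational φ₀.f φ₀.isBirational hresN
  exact hres₀

end PatchingRelPerfect.SliceOfEngine

open PatchingRelPerfect.SliceOfEngine in
/-- **P0 stub γ `stub_sliceOfEngineBlowup` — the dimension-`≤ 4` integral slice from LU and the
blow-up-form roof engine** (`PrintedInputs → RelLUPerfect p → RoofEngineBlowup p →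
ResPerfectIntegralDimLeFour p`, unfolded; binders as the landed `stub_sliceOfEngine`). For `k`
perfect of characteristic `p` and an integral separated `k`-scheme of finite type `X` with
`dim X ≤ 4`, `X` has a resolution of singularities, given Cossart–Piltant in dimension `≤ 3`
(`hG`, with `Stacks07QW_field_holds`), relative LU over perfect fields of characteristic `p`
(`hLU`, reshaped fibrewise at `k`) and the blow-up-form roof engine (`hR`). Reduction to integral
closed subschemes of `ℙⁿ_k` (`ResolutionOverUpToDim.of_projective`), then
`hasResolution_projective_of_dim_le_four_blowup`. The principalization input `hP` is idle.
[cite: Piltant2013, Prop. 5.1 and Cor. 5.7; Zariski1944, p. 539; CossartPiltant2019, Thm. 1.1]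
[cite: Liu2002, Thm. 8.1.24] -/
theorem stub_sliceOfEngineBlowup (p : ℕ) (hp : p.Prime)
    (hG : CossartPiltant2019General.{0}) (hP : CossartPiltant2019Principalization.{0})
    (hLU : ∀ (k K : Type) [Field k] [CharP k p] [PerfectField k] [Field K] [Algebra k K],
      (⊤ : IntermediateField k K).FG → ∀ O : ValuationSubring K, (∀ c : k, algebraMap k K c ∈ O) →
        ∀ R : Subalgebra k K, R.FG → R.toSubring ≤ O.toSubring →
          ∃ (A : Subalgebra k K) (h : A.toSubring ≤ O.toSubring), R ≤ A ∧ A.FG ∧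
            IsFractionRing A K ∧ IsRegularLocalRing (Localization.AtPrime
              (Ideal.comap (Subring.inclusion h) (IsLocalRing.maximalIdeal O))))
    (hR : ∀ (k : Type) [Field k] [CharP k p] [PerfectField k] (M : Scheme.{0})
      (g : M ⟶ Spec (.of k)) [IsSeparated g] [LocallyOfFiniteType g] [QuasiCompact g] [IsIntegral M],
      topologicalKrullDim M = 4 →
      (∀ m : M, IsClosed ({m} : Set M) →
        ∃ (N : Scheme.{0}) (gN : N ⟶ Spec (.of k)) (q : M ⟶ N) (I : N.IdealSheafData),
          IsSeparated gN ∧ LocallyOfFiniteType gN ∧ QuasiCompact gN ∧ IsIntegral N ∧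
          q ≫ gN = g ∧ IsProper q ∧ IsBirational q ∧ topologicalKrullDim N ≤ 4 ∧
          IsRegularLocalRing (N.presheaf.stalk (q.base m)) ∧ I ≠ ⊥ ∧ IsBlowup q I) →
      Scheme.HasResolution M)
    (k : Type) [Field k] [CharP k p] [PerfectField k] (X : Scheme.{0}) (f : X ⟶ Spec (.of k))
    [IsSeparated f] [LocallyOfFiniteType f] [QuasiCompact f] [IsIntegral X]
    (hX : topologicalKrullDim X ≤ 4) : Scheme.HasResolution X := by
  have _ := hp
  have _ := hP
  have hCP : CossartPiltant2019.{0} := hG.cossartPiltant2019 Stacks07QW_field_holds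
  -- (LU) at `k`, in the fibrewise shape
  have hLU' : ∀ (K : Type) [Field K] [Algebra k K] (O : ValuationSubring K) (R : Subalgebra k K),
      R.FG → IsFractionRing R K → R.toSubring ≤ O.toSubring →
        ∃ (A : Subalgebra k K) (h : A.toSubring ≤ O.toSubring), R ≤ A ∧ A.FG ∧
          IsRegularLocalRing (Localization.AtPrime
            (Ideal.comap (Subring.inclusion h) (IsLocalRing.maximalIdeal O))) := by
    intro K _ _ O R hRfg hRfr hRO
    haveI : Algebra.FiniteType k R := R.fg_iff_finiteType.mp hRfg
    haveI : Algebra.EssFiniteType R K :=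
      Algebra.EssFiniteType.of_isLocalization K (nonZeroDivisors R)
    have hKfg : (⊤ : IntermediateField k K).FG :=
      IntermediateField.fg_top_iff.mpr (Algebra.EssFiniteType.comp k R K)
    obtain ⟨A, h, hle, hAfg, -, hreg⟩ :=
      hLU k K hKfg O (fun c => hRO (R.algebraMap_mem c)) R hRfg hRO
    exact ⟨A, h, hle, hAfg, hreg⟩
  -- weak resolution over `k` up to dimension `4`, by reduction to the projective integral case
  have h4 : ResolutionOverUpToDim k 4 :=
    ResolutionOverUpToDim.of_projective fun n Y ι hι hint hY => by
      haveI := hι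
      haveI := hint
      exact hasResolution_projective_of_dim_le_four_blowup hCP hLU' (hR k) Y ι hY
  exact h4 X f ‹_› ‹_› ‹_› inferInstance (by exact_mod_cast hX)

end Summit.ResolutionOfSingularities.ResolutionOfSingularities.Theorems

end
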